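import Summits.MatrixMultiplication.MatrixMultiplication.Theorems.ObstructionDescentGenericRankEngine
import Summits.MatrixMultiplication.MatrixMultiplication.Theorems.ObstructionCalculusSchurWeylDegree
import Summits.MatrixMultiplication.MatrixMultiplication.Theorems.ObstructionDescentUniversalOccurrence

set_option linter.dupNamespace false
set_option autoImplicit false

/-!
# Obstruction descent — universal occurrence from TRIPOD COVERINGS (monomial Jacobian certificates)
# (decomp-mm · lens 3 · gen 32, fourth kernel, def-free)

`route-MatrixMultiplication-ObstructionDescent`, crux `NoOccurrenceObstruction` (`P_O`, stmt 29040); NODE-g32 §1/§3.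

The generic-rank (Jacobian) engine of NODE-g28 (`hwvSpace_eq_bot_of_jacobian`) certifies «`σ_m` fills the coordinate box `ℂ^S`»
by ONE non-singular Jacobian minor of the rank-`m` parametrisation `[A|B|C] = Σ_l A_{•l} ⊗ B_{•l} ⊗ C_{•l}` at ONE rational point.
At a MONOMIAL point (every column of `A, B, C` a standard basis vector: `A_{•l} = e_{φ₀(l)}`, `B_{•l} = e_{φ₁(l)}`, `C_{•l} = e_{φ₂(l)}`)
the Jacobian is a `0/1` matrix: the column of the variable `A_{i l}` is the unit vector of the cell `(i, φ₁ l, φ₂ l)`, and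
similarly for `B_{i l}`, `C_{i l}` (`eval_monomialPoint_pderiv_fromCols`) — the `l`-th summand contributes the TRIPOD of the three
axis-parallel lines through its centre `(φ₀ l, φ₁ l, φ₂ l)`.  Hence if the `m` tripods COVER a box (every cell of the box agrees with
some centre in two coordinates — a covering code of radius one), the box minor is a permutation matrix (here literally the identity,
`jacobian_monomialPoint_eq_one`) and the engine applies: **every cell-covered top box `{j ≥ m−N}³` carries no weight vector vanishing
on `GL_m³·⟨m⟩`, so every partition triple occurring for ANY tensor of format `≤ N` occurs for `⟨m⟩` — `UOCC(m,N)`**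
(`uocc_of_tripodCover`).  Instances by `decide`d coverings: `UOCC(2,2)` (two tripods cover `{0,1}³`), `UOCC(5,3)` (the football-pool
code of `ℤ₃³`, five words), `UOCC(8,4)` and `UOCC(13,5)` (the `⌈q²/2⌉`-codes of `ℤ₄³`, `ℤ₅³`: eight and thirteen words) — so the
universal-occurrence thresholds satisfy **`u(2) ≤ 2`, `u(3) ≤ 5`, `u(4) ≤ 8`, `u(5) ≤ 13` unconditionally** (NODE-g32 §3; in general the
covering codes `K_q(3,1) = ⌈q²/2⌉` give `u(N) ≤ ⌈N²/2⌉`, half the slicing bound `N²`; `u(4) ≤ 7` needs Lickteig's non-monomial certificate).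
No proposition is defined; no `def`; sorry-free; standard axioms.  Nothing here proves `ω = 2`.
[cite: LandsbergGCT2017, §4.7.1 (p. 101: Terracini's lemma), §2.1.6 (p. 33)] [cite: BurgisserIkenmeyer2011, §3.1, Lemma 3.2, §10.4]
[cite: BurgisserClausenShokrollahi1997, Ex. 20.5]
-/

noncomputable section

open scoped BigOperators

namespace Summit.MatrixMultiplication.MatrixMultiplication.Theorems.ObstructionCalculus

open Literature.Computability.AlgebraicComplexity (kroneckerPow isotypicSum₁ isotypicSum₂ isotypicSum₃ unitTensor triad_apply
  card_parts_le_of_isotypicSum₁₂₃_kroneckerPow_ne_zero)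

/-! ## §1  The Jacobian of `[A|B|C]` at a monomial point -/

section Monomial

variable {m : ℕ}

/-- **Jacobian entries at a monomial point.**  At the point `A_{•l} = e_{φ₀ l}`, `B_{•l} = e_{φ₁ l}`, `C_{•l} = e_{φ₂ l}` the partial
derivative of the coordinate `[A|B|C]_{abc} = Σ_l A_{al} B_{bl} C_{cl}` with respect to the variable `(s, i, l)` (entry `(i,l)` of the
`s`-th matrix) is `1` if `(a,b,c)` is the cell obtained from the centre `(φ₀ l, φ₁ l, φ₂ l)` by replacing its `s`-th coordinate with `i`,
and `0` otherwise. [folklore] -/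
theorem eval_monomialPoint_pderiv_fromCols (φ : Fin 3 → Fin m → Fin m) (v : MIdx m) (a b c : Fin m) :
    MvPolynomial.eval (fun w : MIdx m => if w.2.1 = φ w.1 w.2.2 then (1 : ℂ) else 0)
      (MvPolynomial.pderiv v (fromCols (genMat 0) (genMat 1) (genMat 2) a b c)) =
    if a = (if v.1 = 0 then v.2.1 else φ 0 v.2.2) ∧ b = (if v.1 = 1 then v.2.1 else φ 1 v.2.2) ∧
        c = (if v.1 = 2 then v.2.1 else φ 2 v.2.2) then 1 else 0 := by
  classical
  obtain ⟨s, i, l⟩ := v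
  simp only [fromCols, Finset.sum_apply, triad_apply, genMat, map_sum, Derivation.leibniz, MvPolynomial.pderiv_X,
    smul_eq_mul, map_add, map_mul, MvPolynomial.eval_X, Pi.single_apply, Prod.mk.injEq]
  fin_cases s
  · simp only [Fin.zero_eta, Fin.isValue, true_and, one_ne_zero, false_and, if_false, Fin.reduceEq,
      mul_zero, zero_add, add_zero, zero_mul, apply_ite, map_one, map_zero, ite_mul, one_mul]
    rw [Finset.sum_eq_single l (fun l' _ hl' => by simp [hl']) (fun h => (h (Finset.mem_univ l)).elim)]
    by_cases ha : a = i <;> by_cases hb : b = φ 1 l <;> by_cases hc : c = φ 2 l <;> simp [ha, hb, hc]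
  · simp only [Fin.mk_one, Fin.isValue, true_and, one_ne_zero, false_and, if_false, Fin.reduceEq,
      mul_zero, zero_add, add_zero, apply_ite, map_one, map_zero, mul_one]
    rw [Finset.sum_eq_single l (fun l' _ hl' => by simp [hl']) (fun h => (h (Finset.mem_univ l)).elim)]
    by_cases ha : a = φ 0 l <;> by_cases hb : b = i <;> by_cases hc : c = φ 2 l <;> simp [ha, hb, hc]
  · simp only [Fin.reduceFinMk, Fin.isValue, true_and, false_and, if_false, Fin.reduceEq,
      mul_zero, add_zero, apply_ite, map_one, map_zero, mul_one]
    rw [Finset.sum_eq_single l (fun l' _ hl' => by simp [hl']) (fun h => (h (Finset.mem_univ l)).elim)]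
    by_cases ha : a = φ 0 l <;> by_cases hb : b = φ 1 l <;> by_cases hc : c = i <;> simp [ha, hb, hc]

end Monomial

/-! ## §2  Tripod coverings certify the engine -/

section Cover

variable {m : ℕ}

/-- **The box minor at a monomial point is the identity** when each chosen variable covers its own cell: with `c q` a variable whose
cell (centre of tripod `l` with the `s`-th coordinate replaced by `i`) is `q`, the `S × S` Jacobian minor at the monomial point of the
centres `φ` is the identity matrix. [folklore] -/
theorem jacobian_monomialPoint_eq_one (φ : Fin 3 → Fin m → Fin m) (S : Finset (Idx m)) (c : S → MIdx m)
    (hc : ∀ q : S, ((if (c q).1 = 0 then (c q).2.1 else φ 0 (c q).2.2), (if (c q).1 = 1 then (c q).2.1 else φ 1 (c q).2.2),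
      (if (c q).1 = 2 then (c q).2.1 else φ 2 (c q).2.2)) = (q : Idx m)) :
    (Matrix.of fun p q : S => MvPolynomial.eval (fun w : MIdx m => if w.2.1 = φ w.1 w.2.2 then (1 : ℂ) else 0)
      (MvPolynomial.pderiv (c q) (fromCols (genMat 0) (genMat 1) (genMat 2) (p : Idx m).1 (p : Idx m).2.1 (p : Idx m).2.2))) = 1 := by
  classical
  ext p q
  rw [Matrix.of_apply, eval_monomialPoint_pderiv_fromCols, Matrix.one_apply]
  have hq := hc q
  have key : ((p : Idx m).1 = (if (c q).1 = 0 then (c q).2.1 else φ 0 (c q).2.2) ∧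
      (p : Idx m).2.1 = (if (c q).1 = 1 then (c q).2.1 else φ 1 (c q).2.2) ∧
      (p : Idx m).2.2 = (if (c q).1 = 2 then (c q).2.1 else φ 2 (c q).2.2)) ↔ p = q := by
    rw [← Subtype.coe_inj, ← hq, Prod.ext_iff, Prod.ext_iff]
  simp only [key]

/-- **Universal occurrence from a tripod covering** (`N ≤ m`).  If `m` tripods with centres `(φ₀ l, φ₁ l, φ₂ l)` cover the top box
`{j : m ≤ j + N}³` — every cell of the box arises from some centre by changing one coordinate (possibly to itself) — then every
partition triple occurring in a tensor power of ANY complex tensor on an index type of cardinality `≤ N` occurs in the same tensor power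
of the unit tensor `⟨m⟩`: `UOCC(m,N)`.  Proof: zero-pad the tensor into the last `N` indices of format `m`; the occurring type is LIVE
and has `≤ N` rows per factor, so its corner lies in the top box; the monomial Jacobian certificate (`jacobian_monomialPoint_eq_one`,
determinant `1`) feeds the generic-rank engine `hwvSpace_eq_bot_of_jacobian`: no weight vector of that type vanishes on `GL_m³·⟨m⟩`,
so the type occurs for `⟨m⟩` (`isotypicSum_ne_zero_of_not_hwvSpace_le_orbitVanishing`).
[cite: LandsbergGCT2017, §4.7.1 (p. 101), §2.1.6 (p. 33)] [cite: BurgisserIkenmeyer2011, §3.1, Lemma 3.2] -/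
theorem uocc_of_tripodCover {m N : ℕ} (hNm : N ≤ m) (φ : Fin 3 → Fin m → Fin m)
    (hcov : ∀ a b c : Fin m, m ≤ a + N → m ≤ b + N → m ≤ c + N → ∃ v : MIdx m,
      (if v.1 = 0 then v.2.1 else φ 0 v.2.2) = a ∧ (if v.1 = 1 then v.2.1 else φ 1 v.2.2) = b ∧
      (if v.1 = 2 then v.2.1 else φ 2 v.2.2) = c) :
    ∀ {ι : Type} [Fintype ι], Fintype.card ι ≤ N → ∀ (s : ι → ι → ι → ℂ) (d : ℕ)
      (lam : Fin 3 → Nat.Partition d),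
      isotypicSum₁ (lam 0) (isotypicSum₂ (lam 1) (isotypicSum₃ (lam 2) (kroneckerPow s d))) ≠ 0 →
      isotypicSum₁ (lam 0) (isotypicSum₂ (lam 1) (isotypicSum₃ (lam 2) (kroneckerPow (unitTensor ℂ m) d))) ≠ 0 := by
  classical
  intro ι _ hι s d lam hocc
  -- rows of the occurring type
  have hparts := card_parts_le_of_isotypicSum₁₂₃_kroneckerPow_ne_zero hocc
  have hrows : ∀ k : Fin 3, (lam k).parts.card ≤ N := by
    intro k
    fin_cases k
    · exact hparts.1.trans hι
    · exact hparts.2.1.trans hι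
    · exact hparts.2.2.trans hι
  -- zero-pad into format `m`
  have he : Function.Injective (fun i : ι => Fin.castLE (hι.trans hNm) (Fintype.equivFin ι i)) :=
    fun i j hij => (Fintype.equivFin ι).injective (Fin.castLE_injective (hι.trans hNm) hij)
  have hocc' := (isotypicSum_kroneckerPow_padTensor_ne_zero_iff he s lam).2 hocc
  -- the type as a weight label
  set Λ : Fin 3 → Fin m → ℕ := fun k i => (lam k).sortedParts.getD (Fin.rev i) 0 with hΛdef
  have hΛ : ∀ (k : Fin 3) (i : Fin m), Λ k (Fin.rev i) = (lam k).sortedParts.getD i 0 := by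
    intro k i
    show (lam k).sortedParts.getD (Fin.rev (Fin.rev i)) 0 = _
    rw [Fin.rev_rev]
  have hlive : hwvSpace Λ d ≠ ⊥ := (hwvSpace_ne_bot_iff_exists_isotypicSum_ne_zero lam Λ hΛ).2 ⟨_, hocc'⟩
  -- the corner of `Λ` lies in the top box
  have hcorner : ∀ (k : Fin 3) (j : Fin m), Λ k j ≠ 0 → m ≤ (j : ℕ) + N := by
    intro k j hj
    by_contra hlt
    apply hj
    show (lam k).sortedParts.getD (Fin.rev j) 0 = 0
    apply List.getD_eq_default
    rw [Nat.Partition.length_sortedParts, Fin.val_rev]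
    have := hrows k
    omega
  let S : Finset (Idx m) := Finset.univ.filter fun p => m ≤ (p.1 : ℕ) + N ∧ m ≤ (p.2.1 : ℕ) + N ∧ m ≤ (p.2.2 : ℕ) + N
  have hS : ∀ p : Idx m, Λ 0 p.1 ≠ 0 → Λ 1 p.2.1 ≠ 0 → Λ 2 p.2.2 ≠ 0 → p ∈ S := fun p h0 h1 h2 =>
    Finset.mem_filter.2 ⟨Finset.mem_univ _, hcorner 0 _ h0, hcorner 1 _ h1, hcorner 2 _ h2⟩
  -- a covering variable for each cell of the box
  have hcell : ∀ q : S, ∃ v : MIdx m,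
      ((if v.1 = 0 then v.2.1 else φ 0 v.2.2), (if v.1 = 1 then v.2.1 else φ 1 v.2.2),
        (if v.1 = 2 then v.2.1 else φ 2 v.2.2)) = (q : Idx m) := by
    intro q
    obtain ⟨hq0, hq1, hq2⟩ := (Finset.mem_filter.1 q.2).2
    obtain ⟨v, hv0, hv1, hv2⟩ := hcov _ _ _ hq0 hq1 hq2
    exact ⟨v, Prod.ext hv0 (Prod.ext hv1 hv2)⟩
  choose c hc using hcell
  refine isotypicSum_ne_zero_of_not_hwvSpace_le_orbitVanishing (unitTensor ℂ m) lam Λ hΛ fun hle => hlive ?_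
  refine hwvSpace_eq_bot_of_jacobian S hS c (fun w : MIdx m => if w.2.1 = φ w.1 w.2.2 then (1 : ℂ) else 0) ?_ hle
  rw [jacobian_monomialPoint_eq_one φ S c hc, Matrix.det_one]
  exact one_ne_zero

end Cover

/-! ## §3  Instances: `u(2) ≤ 2`, `u(3) ≤ 5`, `u(4) ≤ 8`, `u(5) ≤ 13` -/

/-- **`UOCC(2,2)`**: the two tripods centred at `(0,0,0)` and `(1,1,1)` cover `{0,1}³`; hence every triple occurring for any tensor of
format `≤ 2` occurs for `⟨2⟩` — the universal-occurrence threshold of format `2` is `u(2) ≤ 2` (`σ₂(ℂ²⊗ℂ²⊗ℂ²)` fills).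
[cite: BurgisserClausenShokrollahi1997, Ex. 20.5] [cite: LandsbergGCT2017, §4.7.1] -/
theorem uocc_two_two :
    ∀ {ι : Type} [Fintype ι], Fintype.card ι ≤ 2 → ∀ (s : ι → ι → ι → ℂ) (d : ℕ)
      (lam : Fin 3 → Nat.Partition d),
      isotypicSum₁ (lam 0) (isotypicSum₂ (lam 1) (isotypicSum₃ (lam 2) (kroneckerPow s d))) ≠ 0 →
      isotypicSum₁ (lam 0) (isotypicSum₂ (lam 1) (isotypicSum₃ (lam 2) (kroneckerPow (unitTensor ℂ 2) d))) ≠ 0 :=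
  uocc_of_tripodCover (m := 2) (N := 2) le_rfl (fun _ l => l) (by decide +kernel)

/-- **`UOCC(5,3)`**: the five tripods centred at the football-pool code `{(2,2,4),(2,4,2),(4,2,2),(3,3,3),(4,4,4)}` of the box
`{2,3,4}³` cover it; hence every triple occurring for any tensor of format `≤ 3` occurs for `⟨5⟩` — `u(3) ≤ 5` (`σ₅(ℂ³⊗ℂ³⊗ℂ³)`
fills; `5` is the generic rank of `3×3×3`). [cite: LandsbergGCT2017, §2.1.6 (p. 33), §4.7.1] [cite: BurgisserIkenmeyer2011, Lemma 3.2] -/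
theorem uocc_five_three :
    ∀ {ι : Type} [Fintype ι], Fintype.card ι ≤ 3 → ∀ (s : ι → ι → ι → ℂ) (d : ℕ)
      (lam : Fin 3 → Nat.Partition d),
      isotypicSum₁ (lam 0) (isotypicSum₂ (lam 1) (isotypicSum₃ (lam 2) (kroneckerPow s d))) ≠ 0 →
      isotypicSum₁ (lam 0) (isotypicSum₂ (lam 1) (isotypicSum₃ (lam 2) (kroneckerPow (unitTensor ℂ 5) d))) ≠ 0 :=
  uocc_of_tripodCover (m := 5) (N := 3) (by norm_num) ![![2, 2, 4, 3, 4], ![2, 4, 2, 3, 4], ![4, 2, 2, 3, 4]] (by decide +kernel)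

/-- **`UOCC(8,4)`**: the eight tripods centred at the `q²/2`-code `{444,455,545,554,666,677,767,776}` of the box `{4,5,6,7}³` cover it
(two of the three coordinates of any cell lie in the same half `{4,5}` or `{6,7}`, and the code contains the word of that half with the
prescribed two coordinates); hence every triple occurring for any tensor of format `≤ 4` occurs for `⟨8⟩` — `u(4) ≤ 8` unconditionally
(`u(4) ≤ 7` by Lickteig's typical rank, `uocc_four_of_seven_le`; `u(4) ≥ 6`, `six_le_of_uocc_four`).
[cite: LandsbergGCT2017, §4.7.1] [cite: BurgisserIkenmeyer2011, Lemma 3.2, Lemma 6.1] -/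
theorem uocc_eight_four :
    ∀ {ι : Type} [Fintype ι], Fintype.card ι ≤ 4 → ∀ (s : ι → ι → ι → ℂ) (d : ℕ)
      (lam : Fin 3 → Nat.Partition d),
      isotypicSum₁ (lam 0) (isotypicSum₂ (lam 1) (isotypicSum₃ (lam 2) (kroneckerPow s d))) ≠ 0 →
      isotypicSum₁ (lam 0) (isotypicSum₂ (lam 1) (isotypicSum₃ (lam 2) (kroneckerPow (unitTensor ℂ 8) d))) ≠ 0 :=
  uocc_of_tripodCover (m := 8) (N := 4) (by norm_num)
    ![![4, 4, 5, 5, 6, 6, 7, 7], ![4, 5, 4, 5, 6, 7, 6, 7], ![4, 5, 5, 4, 6, 7, 7, 6]] (by decide +kernel)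

/-- **`UOCC(13,5)`**: thirteen tripods cover the box `{8,…,12}³` (the `⌈q²/2⌉`-code for `q = 5`: nine words on the part
`{8,9,10}` with coordinate sum `≡ 0 (mod 3)`, four on `{11,12}` with even sum); hence every triple occurring for any tensor of format
`≤ 5` occurs for `⟨13⟩` — `u(5) ≤ 13` (the generic rank of `5×5×5` is `10`). [cite: LandsbergGCT2017, §4.7.1, §2.1.6]
[cite: BurgisserIkenmeyer2011, Lemma 3.2] -/
theorem uocc_thirteen_five :
    ∀ {ι : Type} [Fintype ι], Fintype.card ι ≤ 5 → ∀ (s : ι → ι → ι → ℂ) (d : ℕ)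
      (lam : Fin 3 → Nat.Partition d),
      isotypicSum₁ (lam 0) (isotypicSum₂ (lam 1) (isotypicSum₃ (lam 2) (kroneckerPow s d))) ≠ 0 →
      isotypicSum₁ (lam 0) (isotypicSum₂ (lam 1) (isotypicSum₃ (lam 2) (kroneckerPow (unitTensor ℂ 13) d))) ≠ 0 :=
  uocc_of_tripodCover (m := 13) (N := 5) (by norm_num)
    ![![8, 8, 8, 9, 9, 9, 10, 10, 10, 11, 11, 12, 12], ![8, 9, 10, 8, 9, 10, 8, 9, 10, 11, 12, 11, 12],
      ![8, 10, 9, 10, 9, 8, 9, 8, 10, 11, 12, 12, 11]] (by decide +kernel)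

/-- **The `P_O`-cells `(2, m)` hold for every `m ≥ 8`, unconditionally** (from `UOCC(8,4)`, monotonicity in `m`, and
`semigroup_le_matMul_of_uocc`): every type occurring for `⟨2,2,2⟩` occurs for `⟨m⟩`. [cite: BurgisserIkenmeyer2011, §3.1] -/
theorem semigroup_le_two_of_eight_le {m : ℕ} (hm : 8 ≤ m) {d : ℕ} (lam : Fin 3 → Nat.Partition d)
    (hocc : isotypicSum₁ (lam 0) (isotypicSum₂ (lam 1) (isotypicSum₃ (lam 2)
      (kroneckerPow (Literature.Computability.AlgebraicComplexity.matMulTensor ℂ 2 2 2) d))) ≠ 0) :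
    isotypicSum₁ (lam 0) (isotypicSum₂ (lam 1) (isotypicSum₃ (lam 2) (kroneckerPow (unitTensor ℂ m) d))) ≠ 0 :=
  semigroup_le_matMul_of_uocc (N := 4) (n := 2) (by norm_num) (uocc_mono_format hm uocc_eight_four) d lam hocc

end Summit.MatrixMultiplication.MatrixMultiplication.Theorems.ObstructionCalculus

end
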